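import Summits.NavierStokesRegularity.NavierStokesRegularity.Theorems.AncientHullSteeringAncientTruncationBridgeOnpathNoSelfExcitedDynamo
import Summits.NavierStokesRegularity.NavierStokesRegularity.Theses.TypeICertificateLadder
import HarnessLib

/-!
# Route `AncientHullSteering`, rung `AncientTruncationBridge` (stmt-NavierStokesRegularity-20185):
  the rung IS the implication `NoTypeIBlowup → NoSelfExcitedDynamo` between two existing
  positive-side items (stmt-1217 → stmt-1934) — unconditional kernel identity, and the exact
  on-path census in both directions

The companion files pin the on-path lemma `NavierStokesRegularity → AncientTruncationBridge`
CONDITIONALLY on Clay (A) (`…OnpathNoSelfExcitedDynamo`: given (A), rung ⟺ stmt-1934). This file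
removes the condition. Both ends of the rung are, up to `push_neg`, existing items of the tree:

* its ANTECEDENT ("some nontrivial ancient mild solution, `ν = 1`, measurable slices, Type-I
  space–time decay") is `¬ HubbleDynamo.NoSelfExcitedDynamo` (stmt-NavierStokesRegularity-1934, the
  KNSS Type-I Liouville crux; the bounded class reaches the unbounded one by the landed time-shift
  self-improvement `NoSelfExcitedDynamo.Registered.hardness_unbounded_class`) —
  `typeIAncientProfileExists_iff_not_noSelfExcitedDynamo`;
* its CONSEQUENT ("some Leray–Hopf classical solution from a rapidly decaying datum has finite
  maximal lifespan with Type-I rate") is `¬ TypeICertificateLadder.NoTypeIBlowup`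
  (stmt-NavierStokesRegularity-1217, "no Type-I blow-up for Clay data", the shared positive-side
  target; `IsMaximalSmoothSolution` := classical on `[0,T)` ∧ ¬`HasSmoothExtensionPast`) —
  `typeIBlowupExists_iff_not_noTypeIBlowup`.

Hence (`ancientTruncationBridge_iff_noTypeIBlowup_imp_noSelfExcitedDynamo`)

  `AncientTruncationBridge ↔ (TypeICertificateLadder.NoTypeIBlowup → HubbleDynamo.NoSelfExcitedDynamo)`:

the rung is EXACTLY the converse Liouville bridge "Type-I blow-up excluded for Clay data ⟹ no
Type-I ancient profile" (the tree holds the forward bridges `Liouville-class ⟹ NoTypeIBlowup`, e.g.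
`Theorems.noTypeIBlowup_of_typeIAncientLiouville`, `HubbleDynamo.DynamoKillsTypeI`; KNSS 2009 §6).

ON-PATH CENSUS (forward discipline F4), both directions, by item number:
* `noTypeIBlowup_of_navierStokesRegularity` : (A) ⟹ stmt-1217 (Clay-class uniqueness, in tree), so
  `(A) → rung` ⟺ `(A) → stmt-1934` (the companion file's
  `navierStokesRegularity_imp_ancientTruncationBridge_iff_imp_noSelfExcitedDynamo`, which this
  identity explains: under (A) the antecedent stmt-1217 of the bridge is free);
* `not_navierStokesRegularity_imp_ancientTruncationBridge_iff` : `¬(A) → rung` ⟺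
  `NoTypeIBlowup → ¬(A) → NoSelfExcitedDynamo` ("in a world with blow-up but no Type-I blow-up there
  is still no Type-I ancient profile") — open, and DISCHARGED by the shared target `NoTypeII`
  (stmt-NavierStokesRegularity-0056) through the PROVED local Clay theory `NoBlowupToClay`
  (stmt-0055, `Theorems.typeICertificateLadder_noBlowupToClay_proof`):
  `ancientTruncationBridge_of_noTypeII_of_not_navierStokesRegularity`;
* `ancientTruncationBridge_iff_onpath_census` : rung ⟺ `((A) → stmt-1934) ∧ (¬(A) → stmt-1217 → stmt-1934)`,
  so `ancientTruncationBridge_of_noTypeII_of_imp_noSelfExcitedDynamo` : stmt-0056 ∧ ((A) → stmt-1934) ⟹ rung.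

So neither half of the rung is a cheap consequence of the summit statement or of its negation: the
(A)-half is the conditional KNSS Liouville crux stmt-1934, the ¬(A)-half is a consequence of the
Type-II exclusion target stmt-0056. This is the precise content of `forward.on_path = false` for this
rung (lander units fwd2-land-4, -g2, -g3). No statement of any route is asserted; every theorem is an
implication / equivalence between existing declarations. No new definitions.

References: G. Koch, N. Nadirashvili, G. Seregin, V. Šverák, Acta Math. 203 (2009) §1, §6
[KochNadirashviliSereginSverak2009]; G. Seregin, V. Šverák, Comm. PDE 34 (2009), Thm 1.1
[SereginSverak2009]; D. Albritton, T. Barker, arXiv:1811.00502, Thm 1.1 [AlbrittonBarker2019];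
C. Fefferman, Clay problem description (2000/2006), (A) [FeffermanClay2006].
-/

noncomputable section

set_option linter.dupNamespace false

namespace Summit.NavierStokesRegularity.NavierStokesRegularity.Theorems.AncientHullSteeringOnpath

open MeasureTheory
open Literature.Analysis.FluidPDE
open Summit.NavierStokesRegularity.NavierStokesRegularity.Theses

/-- **The rung's consequent is `¬` stmt-1217.** A Leray–Hopf classical solution from a rapidly
decaying datum with finite maximal smooth lifespan `T` and the Type-I rate at `T` exists iff
`TypeICertificateLadder.NoTypeIBlowup` ("every classical Leray–Hopf rapidly-decaying-datum solution
on `[0,T)` with the Type-I rate extends smoothly past `T`", stmt-NavierStokesRegularity-1217) fails —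
`IsMaximalSmoothSolution ν 0 u p T` unfolds to "classical on `Ico 0 T` and no smooth extension past
`T`". [folklore] -/
theorem typeIBlowupExists_iff_not_noTypeIBlowup :
    (∃ ν : ℝ, 0 < ν ∧ ∃ T : ℝ, 0 < T ∧
      ∃ (u : ℝ → EuclideanSpace ℝ (Fin 3) → EuclideanSpace ℝ (Fin 3))
        (p : ℝ → EuclideanSpace ℝ (Fin 3) → ℝ),
      IsMaximalSmoothSolution ν 0 u p T ∧ IsLerayHopfOn T ν 0 (u 0) u ∧
        HasRapidSpatialDecay (u 0) ∧ IsTypeIBlowup u T) ↔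
      ¬ TypeICertificateLadder.NoTypeIBlowup := by
  constructor
  · rintro ⟨ν, hν, T, hT, u, p, ⟨hcl, hext⟩, hLH, hdec, hI⟩ hX
    exact hext (hX ν T hν hT u p hcl hLH hdec hI)
  · intro hX
    by_contra hB
    refine hX fun ν T hν hT u p hcl hLH hdec hI => ?_
    by_contra hext
    exact hB ⟨ν, hν, T, hT, u, p, ⟨hcl, hext⟩, hLH, hdec, hI⟩

/-- **The rung's antecedent is `¬` stmt-1934.** A nontrivial ancient mild solution (`ν = 1`,
measurable slices, NOT assumed bounded near `t = 0`) with Type-I space–time decay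
`‖u(t,x)‖ ≤ C₀/(‖x‖+√(−t))` exists iff the crux `HubbleDynamo.NoSelfExcitedDynamo`
(stmt-NavierStokesRegularity-1934, the same Liouville statement in the BOUNDED ancient class) fails:
`→` by the landed time-shift self-improvement `NoSelfExcitedDynamo.Registered.hardness_unbounded_class`,
`←` because a bounded ancient mild solution is an ancient mild solution. [cite: KochNadirashviliSereginSverak2009, §1] -/
theorem typeIAncientProfileExists_iff_not_noSelfExcitedDynamo :
    (∃ u : ℝ → EuclideanSpace ℝ (Fin 3) → EuclideanSpace ℝ (Fin 3), IsAncientMildSolution 1 u ∧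
      (∀ t < 0, AEStronglyMeasurable (u t) volume) ∧ (∃ C₀ : ℝ, HasTypeIDecay C₀ u) ∧
        ¬ (∀ t < 0, u t =ᵐ[volume] 0)) ↔
      ¬ HubbleDynamo.NoSelfExcitedDynamo := by
  constructor
  · rintro ⟨u, hu, hmeas, hdec, hnt⟩ hN
    exact hnt (NoSelfExcitedDynamo.Registered.hardness_unbounded_class hN u hu hmeas hdec)
  · intro hN
    by_contra hH
    refine hN fun u hu hmeas hdec => ?_
    by_contra hnt
    exact hH ⟨u, hu.isAncientMildSolution, hmeas, hdec, hnt⟩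

/-- **Truncation reading of the rung, by item number**: `AncientTruncationBridge` holds iff a
failure of stmt-1934 (a Type-I ancient profile) forces a failure of stmt-1217 (a Type-I blow-up for
Clay data). [folklore] -/
theorem ancientTruncationBridge_iff_not_noSelfExcitedDynamo_imp_not_noTypeIBlowup :
    AncientHullSteering.AncientTruncationBridge ↔
      (¬ HubbleDynamo.NoSelfExcitedDynamo → ¬ TypeICertificateLadder.NoTypeIBlowup) := by
  constructor
  · intro hR hN
    exact typeIBlowupExists_iff_not_noTypeIBlowup.1
      (hR (typeIAncientProfileExists_iff_not_noSelfExcitedDynamo.2 hN))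
  · intro h hH
    exact typeIBlowupExists_iff_not_noTypeIBlowup.2
      (h (typeIAncientProfileExists_iff_not_noSelfExcitedDynamo.1 hH))

/-- **The rung is the converse Liouville bridge stmt-1217 → stmt-1934.** Unconditionally,
`AncientTruncationBridge ↔ (TypeICertificateLadder.NoTypeIBlowup → HubbleDynamo.NoSelfExcitedDynamo)`:
"if Type-I blow-up is excluded for Clay data then there is no nontrivial Type-I-decaying ancient mild
solution". The tree's landed bridges run the OTHER way (Liouville class ⟹ no Type-I blow-up, KNSS
2009 §6: `Theorems.noTypeIBlowup_of_typeIAncientLiouville`, glue `HubbleDynamo.DynamoKillsTypeI`).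
[cite: KochNadirashviliSereginSverak2009, §6] -/
theorem ancientTruncationBridge_iff_noTypeIBlowup_imp_noSelfExcitedDynamo :
    AncientHullSteering.AncientTruncationBridge ↔
      (TypeICertificateLadder.NoTypeIBlowup → HubbleDynamo.NoSelfExcitedDynamo) :=
  ancientTruncationBridge_iff_not_noSelfExcitedDynamo_imp_not_noTypeIBlowup.trans not_imp_not

/-- **Clay (A) implies stmt-1217.** Under `NavierStokesRegularity` every classical Leray–Hopf
solution from a rapidly decaying datum on `[0,T)` (with or without the Type-I rate) extends past
`T`: otherwise it is a maximal smooth solution of the Type-I blow-up class, which (A) refutes by the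
proved Clay-class uniqueness (`not_typeIBlowupClass_of_navierStokesRegularity`, companion file).
[folklore] -/
theorem noTypeIBlowup_of_navierStokesRegularity (hA : _root_.NavierStokesRegularity) :
    TypeICertificateLadder.NoTypeIBlowup := by
  intro ν T hν hT u p hcl hLH hdec hI
  by_contra hext
  exact not_typeIBlowupClass_of_navierStokesRegularity hA ⟨ν, hν, T, hT, u, p, ⟨hcl, hext⟩, hLH, hdec, hI⟩

/-- **The ¬(A)-half of the rung.** `¬NavierStokesRegularity → AncientTruncationBridge` iff
`NoTypeIBlowup → ¬NavierStokesRegularity → NoSelfExcitedDynamo`: "if Clay (A) fails but Type-I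
blow-up is excluded (so only Type-II blow-up occurs), there is still no Type-I ancient profile" — an
open implication (no Type-I RATE comes with a failure of (A)). [folklore] -/
theorem not_navierStokesRegularity_imp_ancientTruncationBridge_iff :
    (¬ _root_.NavierStokesRegularity → AncientHullSteering.AncientTruncationBridge) ↔
      (TypeICertificateLadder.NoTypeIBlowup → ¬ _root_.NavierStokesRegularity →
        HubbleDynamo.NoSelfExcitedDynamo) :=
  ⟨fun h hI hnA => ancientTruncationBridge_iff_noTypeIBlowup_imp_noSelfExcitedDynamo.1 (h hnA) hI,
    fun h hnA => ancientTruncationBridge_iff_noTypeIBlowup_imp_noSelfExcitedDynamo.2 fun hI => h hI hnA⟩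

/-- **stmt-0056 discharges the ¬(A)-half: under `NoTypeII`, a failure of (A) refutes stmt-1217.**
If every maximal smooth Leray–Hopf solution from a rapidly decaying datum blows up at the Type-I rate
(`TypeICertificateLadder.NoTypeII`, stmt-NavierStokesRegularity-0056) and Clay (A) fails, then
`NoTypeIBlowup` fails: by the PROVED local Clay theory `NoBlowupToClay` (stmt-0055,
`Theorems.typeICertificateLadder_noBlowupToClay_proof`) a failure of (A) yields a classical
Leray–Hopf rapidly-decaying-datum solution on some `[0,T)` with no smooth extension, i.e. a maximal
smooth solution, Type I by stmt-0056, which stmt-1217 would extend. (The argument of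
`Theses.TypeICertificateLadder.closes`, contraposed.) [folklore] -/
theorem not_noTypeIBlowup_of_noTypeII_of_not_navierStokesRegularity
    (hII : TypeICertificateLadder.NoTypeII) (hnA : ¬ _root_.NavierStokesRegularity) :
    ¬ TypeICertificateLadder.NoTypeIBlowup := by
  intro hI
  refine hnA (Theorems.typeICertificateLadder_noBlowupToClay_proof fun ν T hν hT u p hcl hLH hdec => ?_)
  by_contra hext
  exact hext (hI ν T hν hT u p hcl hLH hdec (hII ν T hν hT u p ⟨hcl, hext⟩ hLH hdec))

/-- **Negative-direction on-path lemma, conditional on stmt-0056**: `NoTypeII →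
¬NavierStokesRegularity → AncientTruncationBridge` (the rung's antecedent is not even used: under
stmt-0056 a failure of (A) produces the Type-I blow-up outright). [folklore] -/
theorem ancientTruncationBridge_of_noTypeII_of_not_navierStokesRegularity
    (hII : TypeICertificateLadder.NoTypeII) (hnA : ¬ _root_.NavierStokesRegularity) :
    AncientHullSteering.AncientTruncationBridge :=
  ancientTruncationBridge_iff_noTypeIBlowup_imp_noSelfExcitedDynamo.2 fun hI =>
    absurd hI (not_noTypeIBlowup_of_noTypeII_of_not_navierStokesRegularity hII hnA)

/-- **On-path census of the rung (both directions, by item number).**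
`AncientTruncationBridge ↔ ((A) → stmt-1934) ∧ (¬(A) → stmt-1217 → stmt-1934)`: the (A)-branch is
the conditional KNSS Type-I Liouville crux `HubbleDynamo.NoSelfExcitedDynamo`, the ¬(A)-branch is
"Type-II-only blow-up still excludes Type-I ancient profiles" (discharged by stmt-0056,
`not_noTypeIBlowup_of_noTypeII_of_not_navierStokesRegularity`). Neither branch is a structural
consequence of the summit statement or of its negation — the content of `forward.on_path = false`
for this rung. [folklore] -/
theorem ancientTruncationBridge_iff_onpath_census :
    AncientHullSteering.AncientTruncationBridge ↔
      ((_root_.NavierStokesRegularity → HubbleDynamo.NoSelfExcitedDynamo) ∧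
        (¬ _root_.NavierStokesRegularity → TypeICertificateLadder.NoTypeIBlowup →
          HubbleDynamo.NoSelfExcitedDynamo)) := by
  rw [ancientTruncationBridge_iff_noTypeIBlowup_imp_noSelfExcitedDynamo]
  refine ⟨fun h => ⟨fun hA => h (noTypeIBlowup_of_navierStokesRegularity hA), fun _ hI => h hI⟩, ?_⟩
  rintro ⟨hpos, hneg⟩ hI
  by_cases hA : _root_.NavierStokesRegularity
  · exact hpos hA
  · exact hneg hA hI

/-- **The rung follows from two positive-side statements**: the Type-II exclusion target
`TypeICertificateLadder.NoTypeII` (stmt-0056) together with the (A)-conditional Liouville crux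
`NavierStokesRegularity → HubbleDynamo.NoSelfExcitedDynamo` (conditional stmt-1934) imply
`AncientTruncationBridge` (case split on (A): `ancientTruncationBridge_of_noSelfExcitedDynamo` /
`ancientTruncationBridge_of_noTypeII_of_not_navierStokesRegularity`). [folklore] -/
theorem ancientTruncationBridge_of_noTypeII_of_imp_noSelfExcitedDynamo
    (hII : TypeICertificateLadder.NoTypeII)
    (hL : _root_.NavierStokesRegularity → HubbleDynamo.NoSelfExcitedDynamo) :
    AncientHullSteering.AncientTruncationBridge :=
  ancientTruncationBridge_iff_onpath_census.2
    ⟨hL, fun hnA hI => absurd hI (not_noTypeIBlowup_of_noTypeII_of_not_navierStokesRegularity hII hnA)⟩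

end Summit.NavierStokesRegularity.NavierStokesRegularity.Theorems.AncientHullSteeringOnpath

end
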